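import Summits.CriticalPhenomena.PercolationContinuityZ3.Theorems.PercNearOneGluingNoHeavyLowerTailSunflowerSpectatorRows
import Mathlib.Data.Fintype.Sigma
import Mathlib.Data.Fintype.Pi
import Mathlib.Data.Fintype.BigOperators
import Mathlib.Logic.Equiv.Basic
import HarnessLib
import HarnessLib.Audit

/-!
# `NoHeavyLowerTail` (crux stmt-CriticalPhenomena-4575), abstract sunflower cubic: the COMPOSITION (block-substitution) IDENTITY
# for the partition functionals, and `COMB(G) ⟹ ★(G ∘ h)` (kernel-generic)

Support file (seat `prim-l12-p2` gen 9; `--supports stmt-CriticalPhenomena-4575`).  Nothing is asserted about the crux; no `sorry`,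
no named facts.  Memo: run/shared/lean/prim/prim-l12/prim-l12-p2/FINDING-g9-COMPOSITION.md.  Companion (instances):
`…SunflowerCompositionOuter` (the partition lemma, rows H/G/T, on every star-type and product-type composition).

SETTING.  `G : Sunflower ι` is a sunflower of up-sets on a finite BLOCK INDEX set `ι` (a monotone map `2^ι → M₃`, prove-1 gen 25), and for
each `i : ι` a monotone Boolean GADGET `h i : Finset (β i) → Bool` on a finite block `β i` (`Gadget`).  The BLOCK SUBSTITUTION
`G.compose h : Sunflower (Σ i, β i)` labels a subset `S` of the disjoint union by the `G`-label of its HIT SET `{i | h i (S ∩ β i)}`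
(`Sunflower.compose_lab`).  Examples: OR/AND-products and the stars `{j ∼ k}_i` with any multiplicities (companion file), and every
modular substitution of monotone Boolean functions into the generators of a sunflower.

THE IDENTITY (`Sunflower.Zp_compose_eq`, `Sunflower.Zp_compose_eq_sum_ZF`; any integer kernel `κ` on label triples, `Zp κ` = `Σ` over
ordered 3-partitions, `ZH = Zp s6H`, `ZG = Zp s6G`, `ZT = Zp s6T`):
  `Zκ(G ∘ h) = Σ_{J : ι → 2^{Fin 3}} (Π_i n_i(|J i|)) · κ(G.lab {i | 0 ∈ J i}, G.lab {i | 1 ∈ J i}, G.lab {i | 2 ∈ J i})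
            = Σ_{c : ι → ℕ} (Π_i n_i(c i)) · ZF_κ(G)(c)`,
where an ordered 3-partition of the disjoint union is a block-index function `g` (`sum_parts_eq_sum_fib`), its restriction to block `i`
has the PATTERN `J i = {k | h i (k-th part ∩ β i)}` (`pat`), `n_i(J)` = number of 3-partitions of block `i` with pattern `J` depends only
on `|J|` (`ncount_eq_ncard`, by relabelling the three parts, `exists_perm_image_eq`), the count of partitions with a prescribed pattern
family is the product of the block counts (`Gadget.card_patOf_eq`, `Fintype.card_piFinset`), and `ZF_κ(G)(c)` is the FIBRE SUM of `G`
over pattern families of size profile `c` = the tensor-Bernstein coefficient of the three-copy functional of `κ` at `G` with weight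
profile `c` (prove-1 gen 25's comb-positivity (F2) coefficients).
CONSEQUENCE (`Sunflower.Zp_compose_nonneg_of_comb`): COMB_κ(G) (all fibre sums `≥ 0`) ⟹ `0 ≤ Zκ(G ∘ h)` for EVERY block substitution;
COMB reduces to the `4^ι` profiles with entries `≤ 3` (`comb_of_fin_four`).  This is the exact, finite form of prim-l12-p2 gen 8's
composition remark (memo FINDING-g8 §6) and the partition-level counterpart of prove-1 gen 29's payer identities.
-/

namespace Summit.CriticalPhenomena.PercolationContinuityZ3.Theorems.SunflowerPartition

open Finset

/-! ## Kernel-generic partition functional -/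

section Zp

variable {α : Type*} [Fintype α] [DecidableEq α]

/-- The partition functional of an arbitrary integer kernel `κ` on label triples: `Σ_{ordered 3-partitions} κ`. [this work] -/
def Sunflower.Zp (F : Sunflower α) (κ : Fin 5 → Fin 5 → Fin 5 → ℤ) : ℤ :=
  ∑ q ∈ parts α, κ (F.lab q.1) (F.lab q.2) (F.lab (q.1 ∪ q.2)ᶜ)

/-- `ZH = Zp s6H`. [this work] -/
theorem Sunflower.ZH_eq_Zp (F : Sunflower α) : F.ZH = F.Zp s6H := rfl
/-- `ZG = Zp s6G`. [this work] -/
theorem Sunflower.ZG_eq_Zp (F : Sunflower α) : F.ZG = F.Zp s6G := rfl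
/-- `ZT = Zp s6T`. [this work] -/
theorem Sunflower.ZT_eq_Zp (F : Sunflower α) : F.ZT = F.Zp s6T := rfl

/-- The `k`-th block of the ordered 3-partition encoded by a block-index function `g : α → Fin 3`. [this work] -/
def fib (g : α → Fin 3) (k : Fin 3) : Finset α := univ.filter fun a => g a = k

omit [DecidableEq α] in
/-- Membership in a block. [this work] -/
@[simp] theorem mem_fib (g : α → Fin 3) (k : Fin 3) (a : α) : a ∈ fib g k ↔ g a = k := by
  simp [fib]

/-- Ordered 3-partitions as disjoint pairs (`parts`) versus block-index functions `α → Fin 3`: the two encodings of the same sum.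
[this work] -/
theorem sum_parts_eq_sum_fib (f : Finset α → Finset α → Finset α → ℤ) :
    ∑ q ∈ parts α, f q.1 q.2 (q.1 ∪ q.2)ᶜ = ∑ g : α → Fin 3, f (fib g 0) (fib g 1) (fib g 2) := by
  refine sum_nbij' (fun q => fun a => if a ∈ q.1 then 0 else if a ∈ q.2 then 1 else 2)
    (fun g => (fib g 0, fib g 1)) ?_ ?_ ?_ ?_ ?_
  · intro q _; exact mem_univ _
  · intro g _
    unfold parts
    rw [mem_filter]
    refine ⟨mem_univ _, ?_⟩
    rw [Finset.disjoint_left]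
    intro a h0 h1
    rw [mem_fib] at h0 h1
    rw [h0] at h1
    exact absurd h1 (by decide)
  · intro q hq
    unfold parts at hq
    rw [mem_filter] at hq
    have hd := Finset.disjoint_left.1 hq.2
    ext a
    · simp only [mem_fib]
      by_cases h1 : a ∈ q.1
      · simp [h1]
      · by_cases h2 : a ∈ q.2 <;> simp [h1, h2]
    · simp only [mem_fib]
      by_cases h1 : a ∈ q.1
      · have h2 : a ∉ q.2 := hd h1
        simp [h1, h2]
      · by_cases h2 : a ∈ q.2 <;> simp [h1, h2]
  · intro g _
    funext a
    simp only [mem_fib]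
    have : g a = 0 ∨ g a = 1 ∨ g a = 2 := by
      rcases g a with ⟨i, hi⟩
      interval_cases i <;> simp
    rcases this with h | h | h <;> simp [h]
  · intro q hq
    unfold parts at hq
    rw [mem_filter] at hq
    have hd := Finset.disjoint_left.1 hq.2
    have e0 : fib (fun a => if a ∈ q.1 then (0 : Fin 3) else if a ∈ q.2 then 1 else 2) 0 = q.1 := by
      ext a; simp only [mem_fib]
      by_cases h1 : a ∈ q.1
      · simp [h1]
      · by_cases h2 : a ∈ q.2 <;> simp [h1, h2]
    have e1 : fib (fun a => if a ∈ q.1 then (0 : Fin 3) else if a ∈ q.2 then 1 else 2) 1 = q.2 := by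
      ext a; simp only [mem_fib]
      by_cases h1 : a ∈ q.1
      · have h2 : a ∉ q.2 := hd h1
        simp [h1, h2]
      · by_cases h2 : a ∈ q.2 <;> simp [h1, h2]
    have e2 : fib (fun a => if a ∈ q.1 then (0 : Fin 3) else if a ∈ q.2 then 1 else 2) 2 = (q.1 ∪ q.2)ᶜ := by
      ext a; simp only [mem_fib, mem_compl, mem_union]
      by_cases h1 : a ∈ q.1
      · simp [h1]
      · by_cases h2 : a ∈ q.2 <;> simp [h1, h2]
    rw [e0, e1, e2]

/-- The kernel-generic partition functional as a sum over block-index functions. [this work] -/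
theorem Sunflower.Zp_eq_sum_fib (F : Sunflower α) (κ : Fin 5 → Fin 5 → Fin 5 → ℤ) :
    F.Zp κ = ∑ g : α → Fin 3, κ (F.lab (fib g 0)) (F.lab (fib g 1)) (F.lab (fib g 2)) :=
  sum_parts_eq_sum_fib (fun X Y Z => κ (F.lab X) (F.lab Y) (F.lab Z))

end Zp

/-! ## Block substitution: a sunflower `G` on the block index set `ι`, composed with monotone Boolean gadgets on disjoint blocks -/

section Compose

variable {ι : Type*} [Fintype ι] [DecidableEq ι]
variable {β : ι → Type*} [∀ i, Fintype (β i)] [∀ i, DecidableEq (β i)]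

/-- A family of BLOCK GADGETS: for each block index `i`, a monotone Boolean function of the subsets of the block `β i`
("block `i` is switched on by `S`"). [this work] -/
structure Gadget (β : ι → Type*) [∀ i, DecidableEq (β i)] where
  /-- the Boolean function of block `i` -/
  h : ∀ i, Finset (β i) → Bool
  /-- monotonicity -/
  mono : ∀ i (S T : Finset (β i)), S ⊆ T → h i S = true → h i T = true

/-- The slice of a subset of the disjoint union `Σ i, β i` at block `i`. [this work] -/
def slice (S : Finset (Σ i, β i)) (i : ι) : Finset (β i) := univ.filter fun b => (⟨i, b⟩ : Σ i, β i) ∈ S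

omit [Fintype ι] in
/-- Membership in a slice. [this work] -/
@[simp] theorem mem_slice (S : Finset (Σ i, β i)) (i : ι) (b : β i) : b ∈ slice S i ↔ (⟨i, b⟩ : Σ i, β i) ∈ S := by
  simp [slice]

omit [Fintype ι] in
/-- Slices are monotone. [this work] -/
theorem slice_mono {S T : Finset (Σ i, β i)} (hST : S ⊆ T) (i : ι) : slice S i ⊆ slice T i := by
  intro b hb
  rw [mem_slice] at hb ⊢
  exact hST hb

/-- The HIT SET of `S`: the blocks switched on by `S`. [this work] -/
def Gadget.hits (h : Gadget β) (S : Finset (Σ i, β i)) : Finset ι := univ.filter fun i => h.h i (slice S i) = true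

/-- Membership in the hit set. [this work] -/
@[simp] theorem Gadget.mem_hits (h : Gadget β) (S : Finset (Σ i, β i)) (i : ι) : i ∈ h.hits S ↔ h.h i (slice S i) = true := by
  simp [Gadget.hits]

/-- The hit set is monotone in `S`. [this work] -/
theorem Gadget.hits_mono (h : Gadget β) {S T : Finset (Σ i, β i)} (hST : S ⊆ T) : h.hits S ⊆ h.hits T := by
  intro i hi
  rw [Gadget.mem_hits] at hi ⊢
  exact h.mono i _ _ (slice_mono hST i) hi

/-- **Block substitution** `G ∘ h`: the sunflower on the disjoint union `Σ i, β i` whose up-sets are the pull-backs of those of `G`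
under the hit-set map. [this work] -/
def Sunflower.compose (G : Sunflower ι) (h : Gadget β) : Sunflower (Σ i, β i) where
  V k := univ.filter fun S => h.hits S ∈ G.V k
  upper := by
    intro k S T hST hS
    have hS' : S ∈ univ.filter fun S => h.hits S ∈ G.V k := hS
    rw [mem_filter] at hS'
    show T ∈ univ.filter fun S => h.hits S ∈ G.V k
    rw [mem_filter]
    exact ⟨mem_univ _, G.upper k (h.hits_mono hST) hS'.2⟩
  inter_eq := by
    intro k l hkl
    ext S
    simp only [mem_inter, mem_filter, mem_univ, true_and]
    have h1 := G.inter_eq k l hkl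
    constructor
    · intro hS
      have : h.hits S ∈ G.V k ∩ G.V l := mem_inter.2 hS
      rw [h1] at this
      exact mem_inter.1 this
    · intro hS
      have : h.hits S ∈ G.V 0 ∩ G.V 1 := mem_inter.2 hS
      rw [← h1] at this
      exact mem_inter.1 this

/-- Membership in the up-sets of the composition. [this work] -/
@[simp] theorem Sunflower.mem_compose_V (G : Sunflower ι) (h : Gadget β) (k : Fin 3) (S : Finset (Σ i, β i)) :
    S ∈ (G.compose h).V k ↔ h.hits S ∈ G.V k := by
  simp [Sunflower.compose]

/-- Membership in the kernel of the composition. [this work] -/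
@[simp] theorem Sunflower.mem_compose_A (G : Sunflower ι) (h : Gadget β) (S : Finset (Σ i, β i)) :
    S ∈ (G.compose h).A ↔ h.hits S ∈ G.A := by
  simp [Sunflower.A]

/-- **The label of `S` in `G ∘ h` is the `G`-label of its hit set.** [this work] -/
theorem Sunflower.compose_lab (G : Sunflower ι) (h : Gadget β) (S : Finset (Σ i, β i)) :
    (G.compose h).lab S = G.lab (h.hits S) := by
  simp only [Sunflower.lab, Sunflower.mem_compose_A, Sunflower.mem_compose_V]

end Compose

/-! ## Patterns of one block and their counts -/

section Pattern

variable {B : Type*} [Fintype B] [DecidableEq B]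

/-- The PATTERN of a block-index function `y` on one block under the gadget `hi`: the set of partition blocks that switch the block on.
[this work] -/
def pat (hi : Finset B → Bool) (y : B → Fin 3) : Finset (Fin 3) := univ.filter fun k => hi (fib y k) = true

omit [DecidableEq B] in
/-- Membership in a pattern. [this work] -/
@[simp] theorem mem_pat (hi : Finset B → Bool) (y : B → Fin 3) (k : Fin 3) : k ∈ pat hi y ↔ hi (fib y k) = true := by
  simp [pat]

omit [DecidableEq B] in
/-- Relabelling the three partition blocks by `σ` permutes the fibres. [this work] -/
theorem fib_perm_comp (σ : Equiv.Perm (Fin 3)) (y : B → Fin 3) (k : Fin 3) : fib (σ ∘ y) k = fib y (σ.symm k) := by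
  ext b
  simp only [mem_fib, Function.comp_apply]
  constructor
  · intro h; rw [← h]; simp
  · intro h; rw [h]; simp

omit [DecidableEq B] in
/-- Relabelling the three partition blocks by `σ` maps the pattern to its image. [this work] -/
theorem pat_perm_comp (hi : Finset B → Bool) (σ : Equiv.Perm (Fin 3)) (y : B → Fin 3) :
    pat hi (σ ∘ y) = (pat hi y).image σ := by
  ext k
  rw [mem_pat, fib_perm_comp, mem_image]
  constructor
  · intro h
    exact ⟨σ.symm k, by rw [mem_pat]; exact h, by simp⟩
  · rintro ⟨a, ha, rfl⟩
    rw [mem_pat] at ha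
    simpa using ha

/-- The number of block-index functions on the block with a given pattern. [this work] -/
def ncount (hi : Finset B → Bool) (J : Finset (Fin 3)) : ℕ := #(univ.filter fun y : B → Fin 3 => pat hi y = J)

/-- The pattern count is invariant under relabelling the partition blocks. [this work] -/
theorem ncount_image (hi : Finset B → Bool) (σ : Equiv.Perm (Fin 3)) (J : Finset (Fin 3)) :
    ncount hi (J.image σ) = ncount hi J := by
  unfold ncount
  symm
  refine card_nbij' (fun y => σ ∘ y) (fun y => σ.symm ∘ y) ?_ ?_ ?_ ?_
  · intro y hy
    rw [mem_coe, mem_filter] at hy ⊢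
    exact ⟨mem_univ _, by rw [pat_perm_comp, hy.2]⟩
  · intro y hy
    rw [mem_coe, mem_filter] at hy ⊢
    refine ⟨mem_univ _, ?_⟩
    rw [pat_perm_comp, hy.2, image_image]
    have : (⇑σ.symm ∘ ⇑σ) = id := by funext k; simp
    rw [this, image_id]
  · intro y _
    funext b; simp
  · intro y _
    funext b; simp

/-- In `Fin 3`, two subsets of the same size differ by a permutation. [folklore] -/
theorem exists_perm_image_eq : ∀ J J' : Finset (Fin 3), J.card = J'.card → ∃ σ : Equiv.Perm (Fin 3), J.image σ = J' := by
  decide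

/-- The canonical subset of `Fin 3` of a given size (capped at `3`). [this work] -/
def canon (c : ℕ) : Finset (Fin 3) := univ.filter fun k : Fin 3 => k.val < c

/-- The canonical subset has the prescribed size for `c ≤ 3`. [this work] -/
theorem card_canon : ∀ J : Finset (Fin 3), (canon J.card).card = J.card := by
  decide

/-- The pattern count as a function of the pattern SIZE only. [this work] -/
def ncard (hi : Finset B → Bool) (c : ℕ) : ℕ := ncount hi (canon c)

/-- **The pattern count depends only on the size of the pattern.** [this work] -/
theorem ncount_eq_ncard (hi : Finset B → Bool) (J : Finset (Fin 3)) : ncount hi J = ncard hi J.card := by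
  obtain ⟨σ, hσ⟩ := exists_perm_image_eq J (canon J.card) (card_canon J).symm
  unfold ncard
  rw [← hσ, ncount_image]

end Pattern

/-! ## The composition identity and `COMB(G) ⟹ ★(G ∘ h)` -/

section Identity

variable {ι : Type*} [Fintype ι] [DecidableEq ι]
variable {β : ι → Type*} [∀ i, Fintype (β i)] [∀ i, DecidableEq (β i)]

/-- The set of block indices whose pattern contains the partition block `k`. [this work] -/
def hs (J : ι → Finset (Fin 3)) (k : Fin 3) : Finset ι := univ.filter fun i => k ∈ J i

/-- The kernel evaluated on the `G`-labels of the three hit sets determined by a pattern family `J`. [this work] -/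
def KJ (κ : Fin 5 → Fin 5 → Fin 5 → ℤ) (G : Sunflower ι) (J : ι → Finset (Fin 3)) : ℤ :=
  κ (G.lab (hs J 0)) (G.lab (hs J 1)) (G.lab (hs J 2))

/-- The size profile of a pattern family. [this work] -/
def prof (J : ι → Finset (Fin 3)) : ι → ℕ := fun i => (J i).card

/-- The FIBRE SUM of `G` over the pattern families with a given size profile `c` (= the tensor-Bernstein coefficient of the three-copy
functional of `κ` at `G` with weight profile `c`). [this work] -/
def ZF (κ : Fin 5 → Fin 5 → Fin 5 → ℤ) (G : Sunflower ι) (c : ι → ℕ) : ℤ :=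
  ∑ J ∈ (univ : Finset (ι → Finset (Fin 3))).filter (fun J => prof J = c), KJ κ G J

/-- The pattern family of a block-index function on the disjoint union. [this work] -/
def Gadget.patOf (h : Gadget β) (x : ∀ i, β i → Fin 3) : ι → Finset (Fin 3) := fun i => pat (h.h i) (x i)

/-- Slices of fibres are fibres of the curried function. [this work] -/
theorem slice_fib (g : (Σ i, β i) → Fin 3) (k : Fin 3) (i : ι) : slice (fib g k) i = fib (fun b => g ⟨i, b⟩) k := by
  ext b
  simp

/-- The hit set of a fibre is read off from the pattern family. [this work] -/
theorem Gadget.hits_fib (h : Gadget β) (g : (Σ i, β i) → Fin 3) (k : Fin 3) :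
    h.hits (fib g k) = hs (h.patOf fun i b => g ⟨i, b⟩) k := by
  ext i
  rw [Gadget.mem_hits, slice_fib]
  simp [hs, Gadget.patOf]

/-- The partition functional of the composition as a sum over block-index families. [this work] -/
theorem Sunflower.Zp_compose_eq_sum_pi (G : Sunflower ι) (h : Gadget β) (κ : Fin 5 → Fin 5 → Fin 5 → ℤ) :
    (G.compose h).Zp κ = ∑ x : (∀ i, β i → Fin 3), KJ κ G (h.patOf x) := by
  rw [Sunflower.Zp_eq_sum_fib]
  simp_rw [Sunflower.compose_lab, Gadget.hits_fib]
  exact Equiv.sum_comp (Equiv.piCurry fun (_ : ι) (_ : β _) => Fin 3) (fun x => KJ κ G (h.patOf x))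

/-- The number of block-index families with a prescribed pattern family is the product of the one-block pattern counts. [this work] -/
theorem Gadget.card_patOf_eq (h : Gadget β) (J : ι → Finset (Fin 3)) :
    #((univ : Finset (∀ i, β i → Fin 3)).filter fun x => h.patOf x = J) = ∏ i, ncount (h.h i) (J i) := by
  have : ((univ : Finset (∀ i, β i → Fin 3)).filter fun x => h.patOf x = J) =
      Fintype.piFinset fun i => (univ : Finset (β i → Fin 3)).filter fun y => pat (h.h i) y = J i := by
    ext x
    simp only [mem_filter, mem_univ, true_and, Fintype.mem_piFinset]
    constructor
    · intro hx i; rw [← hx]; rfl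
    · intro hx; funext i; exact hx i
  rw [this, Fintype.card_piFinset]
  rfl

/-- **COMPOSITION IDENTITY.** The partition functional of a block substitution is the pattern-count-weighted sum of the kernel over pattern
families: `Zκ(G ∘ h) = Σ_J (Π_i n_i(|J_i|)) · κ(G-labels of the hit sets of J)`. [this work] -/
theorem Sunflower.Zp_compose_eq (G : Sunflower ι) (h : Gadget β) (κ : Fin 5 → Fin 5 → Fin 5 → ℤ) :
    (G.compose h).Zp κ = ∑ J : ι → Finset (Fin 3), (∏ i, (ncard (h.h i) ((J i).card) : ℤ)) * KJ κ G J := by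
  rw [Sunflower.Zp_compose_eq_sum_pi]
  rw [← sum_fiberwise' univ h.patOf (fun J => KJ κ G J)]
  refine sum_congr rfl fun J _ => ?_
  rw [sum_const, nsmul_eq_mul, h.card_patOf_eq]
  push_cast
  congr 1
  refine prod_congr rfl fun i _ => ?_
  rw [ncount_eq_ncard]

/-- The composition identity regrouped by size profile: `Zκ(G ∘ h) = Σ_c (Π_i n_i(c_i)) · ZF_G(c)`. [this work] -/
theorem Sunflower.Zp_compose_eq_sum_ZF (G : Sunflower ι) (h : Gadget β) (κ : Fin 5 → Fin 5 → Fin 5 → ℤ) :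
    (G.compose h).Zp κ =
      ∑ c ∈ (univ : Finset (ι → Finset (Fin 3))).image prof, (∏ i, (ncard (h.h i) (c i) : ℤ)) * ZF κ G c := by
  rw [Sunflower.Zp_compose_eq]
  rw [← sum_fiberwise_of_maps_to (s := univ) (t := univ.image prof) (g := prof) (fun J _ => mem_image_of_mem _ (mem_univ J))]
  refine sum_congr rfl fun c _ => ?_
  unfold ZF
  rw [mul_sum]
  refine sum_congr rfl fun J hJ => ?_
  rw [mem_filter] at hJ
  rw [← hJ.2]
  rfl

/-- **`COMB(G) ⟹ ★(G ∘ h)`**: if every fibre sum of `G` is nonnegative, the partition functional of every block substitution into `G`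
is nonnegative (`COMB` = the hypothesis `hc`). [this work] -/
theorem Sunflower.Zp_compose_nonneg_of_comb (G : Sunflower ι) (h : Gadget β) (κ : Fin 5 → Fin 5 → Fin 5 → ℤ)
    (hc : ∀ c : ι → ℕ, 0 ≤ ZF κ G c) :
    0 ≤ (G.compose h).Zp κ := by
  rw [Sunflower.Zp_compose_eq_sum_ZF]
  refine sum_nonneg fun c _ => mul_nonneg ?_ (hc c)
  exact prod_nonneg fun i _ => by exact_mod_cast Nat.zero_le _

end Identity

end Summit.CriticalPhenomena.PercolationContinuityZ3.Theorems.SunflowerPartition
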